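import Summits.PneNP.PneNP.Theorems.SymmetryBudgetNoHiddenOrderProgramGates
import Summits.PneNP.PneNP.Theorems.SymmetryBudgetNoHiddenOrderReplayRootDefs

/-!
# `NoHiddenOrder` (stmt-PneNP-14781), (R2c) VI: the window canoniser program — kinds and sources of the small shapes

Route `PneNP/SymmetryBudget`; continues `SymmetryBudgetNoHiddenOrderProgramGates.lean`.  For each gate shape, its KIND and its SOURCE SET as a
function of the shape's input wires and of the embedding of the shape into the gate type — written so that the corresponding kit structure
(`CmpCount`, `CmpTwice`, `RefineIter` + `RefVal`, `VecCmp`) is satisfied by `rfl`: `ccKind/ccSrcs`, `ctKind/ctSrcs`, `riKind/riSrcs`,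
`vsKind/vsSrcs`, `voKind/voSrcs`, `vaKind/vaSrcs`.  The larger shapes and the dispatch are in `…ProgramSrcsB/C.lean`.  Definitions only; supports
stmt-PneNP-14781.
-/

set_option linter.dupNamespace false -- `Summit.PneNP.PneNP.…` (D-0017 single-conjunct layout)

namespace Summit.PneNP.PneNP.Theorems

open Finset CGBits BranchSum Literature.Computability.Complexity Literature.Computability.Complexity.SymProg

namespace WCanon

variable {m : ℕ}

/-- The wires of the program at size `m`. [folklore] -/
abbrev Wire (m : ℕ) : Type := (Fin m × Fin m) ⊕ Gt m

/-! ### `CmpCount` -/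

/-- Kinds of a `CmpCount` shape. [folklore] -/
def ccKind : CCGate m → Kind
  | .geA θ => .atLeast θ
  | .geB θ => .atLeast θ
  | .ngeA _ => .nor
  | .both _ => .and
  | .none _ => .nor
  | .eqv _ => .or
  | .eq => .and
  | .ltw _ => .and
  | .lt => .or

/-- Sources of a `CmpCount` shape with wire sets `A`, `B`, embedded by `e`. [folklore] -/
def ccSrcs (A B : Finset (Wire m)) (e : CCGate m → Gt m) : CCGate m → Finset (Wire m)
  | .geA _ => A
  | .geB _ => B
  | .ngeA θ => {Sum.inr (e (.geA θ))}
  | .both θ => {Sum.inr (e (.geA θ)), Sum.inr (e (.geB θ))}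
  | .none θ => {Sum.inr (e (.geA θ)), Sum.inr (e (.geB θ))}
  | .eqv θ => {Sum.inr (e (.both θ)), Sum.inr (e (.none θ))}
  | .eq => univ.image fun θ => Sum.inr (e (.eqv θ))
  | .ltw θ => {Sum.inr (e (.ngeA θ)), Sum.inr (e (.geB θ))}
  | .lt => univ.image fun θ => Sum.inr (e (.ltw θ))

/-! ### `CmpTwice` -/

/-- Kinds of a `CmpTwice` shape. [folklore] -/
def ctKind : CTGate m → Kind
  | .ge2A θ => .atLeast (2 * θ)
  | .geB θ => .atLeast θ
  | .nge2A _ => .nor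
  | .tww _ => .and
  | .tw => .or

/-- Sources of a `CmpTwice` shape. [folklore] -/
def ctSrcs (A B : Finset (Wire m)) (e : CTGate m → Gt m) : CTGate m → Finset (Wire m)
  | .ge2A _ => A
  | .geB _ => B
  | .nge2A θ => {Sum.inr (e (.ge2A θ))}
  | .tww θ => {Sum.inr (e (.geB θ)), Sum.inr (e (.nge2A θ))}
  | .tw => (univ.filter fun θ : Fin (pN m + 1) => 1 ≤ (θ : ℕ)).image fun θ => Sum.inr (e (.tww θ))

/-! ### `RefineIter` with value read-out -/

/-- The input wires of a refinement site: membership, adjacency, initial order and kernel. [folklore] -/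
structure RIIn (m : ℕ) where
  /-- membership -/
  mem : WV m → Wire m
  /-- adjacency -/
  adj : WV m → WV m → Wire m
  /-- initial order -/
  lt0 : WV m → WV m → Wire m
  /-- initial kernel -/
  eq0 : WV m → WV m → Wire m

/-- The order wire entering round `r ≤ T = wn m` (shape of `RefineIter.ltW`). [folklore] -/
def riLtW (ι : RIIn m) (e : RIGate m → Gt m) (r : Fin (wn m + 1)) (u v : WV m) : Wire m :=
  if _h : (r : ℕ) = 0 then ι.lt0 u v else Sum.inr (e (.ltS ⟨r - 1, by omega⟩ u v))

/-- The kernel wire entering round `r ≤ T`. [folklore] -/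
def riEqW (ι : RIIn m) (e : RIGate m → Gt m) (r : Fin (wn m + 1)) (u v : WV m) : Wire m :=
  if _h : (r : ℕ) = 0 then ι.eq0 u v else Sum.inr (e (.eqS ⟨r - 1, by omega⟩ u v))

/-- Kinds of a refinement shape. [folklore] -/
def riKind : RIGate m → Kind
  | .c _ _ _ _ => .and
  | .cmp _ _ _ _ g => ccKind g
  | .nmem _ => .nor
  | .nlt _ _ _ => .nor
  | .pre _ _ _ _ _ => .or
  | .allpre _ _ _ _ => .and
  | .wit _ _ _ _ => .and
  | .prof _ _ _ => .or
  | .tie _ _ _ => .and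
  | .ltS _ _ _ => .or
  | .eqS _ _ _ => .nor
  | .vc _ _ => .and
  | .vge _ t => .atLeast t
  | .vnge _ _ => .nor
  | .vinA _ _ => .and
  | .vnm _ => .nor
  | .vval _ _ => .or

/-- Sources of a refinement shape with inputs `ι`, embedded by `e`. [folklore] -/
def riSrcs (ι : RIIn m) (e : RIGate m → Gt m) : RIGate m → Finset (Wire m)
  | .c r u w y => {ι.mem y, ι.adj u y, (if _h : (r : ℕ) = 0 then ι.eq0 y w else Sum.inr (e (.eqS ⟨r - 1, by omega⟩ y w)))}
  | .cmp r u v w g =>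
      ccSrcs (univ.image fun y => Sum.inr (e (.c r u w y))) (univ.image fun y => Sum.inr (e (.c r v w y)))
        (fun g' => e (.cmp r u v w g')) g
  | .nmem w => {ι.mem w}
  | .nlt r w' w => {(if _h : (r : ℕ) = 0 then ι.lt0 w' w else Sum.inr (e (.ltS ⟨r - 1, by omega⟩ w' w)))}
  | .pre r u v w w' => {Sum.inr (e (.nmem w')), Sum.inr (e (.nlt r w' w)), Sum.inr (e (.cmp r u v w' .eq))}
  | .allpre r u v w => univ.image fun w' => Sum.inr (e (.pre r u v w w'))
  | .wit r u v w => {ι.mem w, Sum.inr (e (.cmp r u v w .lt)), Sum.inr (e (.allpre r u v w))}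
  | .prof r u v => univ.image fun w => Sum.inr (e (.wit r u v w))
  | .tie r u v => {(if _h : (r : ℕ) = 0 then ι.eq0 u v else Sum.inr (e (.eqS ⟨r - 1, by omega⟩ u v))), Sum.inr (e (.prof r u v))}
  | .ltS r u v => {(if _h : (r : ℕ) = 0 then ι.lt0 u v else Sum.inr (e (.ltS ⟨r - 1, by omega⟩ u v))), Sum.inr (e (.tie r u v))}
  | .eqS r u v => {Sum.inr (e (.ltS r u v)), Sum.inr (e (.ltS r v u))}
  | .vc w v => {ι.mem w, riLtW ι e (Fin.last (wn m)) w v}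
  | .vge v _ => univ.image fun w => Sum.inr (e (.vc w v))
  | .vnge v t => {Sum.inr (e (.vge v t))}
  | .vinA v t => {ι.mem v, Sum.inr (e (.vge v t.castSucc)), Sum.inr (e (.vnge v t.succ))}
  | .vnm v => {ι.mem v}
  | .vval v t => if (t : ℕ) = 0 then {Sum.inr (e (.vinA v t)), Sum.inr (e (.vnm v))} else {Sum.inr (e (.vinA v t))}

/-! ### The three `VecCmp` shapes -/

/-- Kinds of the signature comparison shape. [folklore] -/
def vsKind : VSGate m → Kind
  | .both _ _ _ => .and
  | .none _ _ _ => .nor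
  | .eqv _ _ _ => .or
  | .nb _ _ => .nor
  | .lt _ _ _ => .and
  | .less _ _ => .or
  | .eqall _ _ => .and

/-- Sources of the signature comparison shape with bit wires `b`, embedded by `e`. [folklore] -/
def vsSrcs (b : WV m → Fin (m + m) → Wire m) (e : VSGate m → Gt m) : VSGate m → Finset (Wire m)
  | .both k k' j => {b k j, b k' j}
  | .none k k' j => {b k j, b k' j}
  | .eqv k k' j => {Sum.inr (e (.both k k' j)), Sum.inr (e (.none k k' j))}
  | .nb k j => {b k j}
  | .lt k k' j => ((univ.filter fun q => q < j).image fun q => Sum.inr (e (.eqv k k' q))) ∪ {Sum.inr (e (.nb k j)), b k' j}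
  | .less k k' => univ.image fun j => Sum.inr (e (.lt k k' j))
  | .eqall k k' => univ.image fun j => Sum.inr (e (.eqv k k' j))

/-- Kinds of the candidates' comparison shape. [folklore] -/
def voKind : VOGate m → Kind
  | .both _ _ _ => .and
  | .none _ _ _ => .nor
  | .eqv _ _ _ => .or
  | .nb _ _ => .nor
  | .lt _ _ _ => .and
  | .less _ _ => .or
  | .eqall _ _ => .and

/-- Sources of the candidates' comparison shape. [folklore] -/
def voSrcs (b : WV m × Fin (wn m) → Fin (NB (wn m)) → Wire m) (e : VOGate m → Gt m) : VOGate m → Finset (Wire m)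
  | .both k k' j => {b k j, b k' j}
  | .none k k' j => {b k j, b k' j}
  | .eqv k k' j => {Sum.inr (e (.both k k' j)), Sum.inr (e (.none k k' j))}
  | .nb k j => {b k j}
  | .lt k k' j => ((univ.filter fun q => q < j).image fun q => Sum.inr (e (.eqv k k' q))) ∪ {Sum.inr (e (.nb k j)), b k' j}
  | .less k k' => univ.image fun j => Sum.inr (e (.lt k k' j))
  | .eqall k k' => univ.image fun j => Sum.inr (e (.eqv k k' j))

/-- Kinds of the parts' comparison shape. [folklore] -/
def vaKind : VAGate m → Kind
  | .both _ _ _ => .and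
  | .none _ _ _ => .nor
  | .eqv _ _ _ => .or
  | .nb _ _ => .nor
  | .lt _ _ _ => .and
  | .less _ _ => .or
  | .eqall _ _ => .and

/-- Sources of the parts' comparison shape. [folklore] -/
def vaSrcs (b : Finset (WV m) → Fin (NB (wn m)) → Wire m) (e : VAGate m → Gt m) : VAGate m → Finset (Wire m)
  | .both k k' j => {b k j, b k' j}
  | .none k k' j => {b k j, b k' j}
  | .eqv k k' j => {Sum.inr (e (.both k k' j)), Sum.inr (e (.none k k' j))}
  | .nb k j => {b k j}
  | .lt k k' j => ((univ.filter fun q => q < j).image fun q => Sum.inr (e (.eqv k k' q))) ∪ {Sum.inr (e (.nb k j)), b k' j}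
  | .less k k' => univ.image fun j => Sum.inr (e (.lt k k' j))
  | .eqall k k' => univ.image fun j => Sum.inr (e (.eqv k k' j))

/-! ### Root data -/

/-- The root label `(univ, ∅, 0)` is admissible. [folklore] -/
theorem admB_root (m : ℕ) : AdmB (Bw m) (∅ : Finset (WV m)) fun _ => ((0 : ℕ)) := by
  unfold AdmB; simp

/-- Zero as a colour index, at a non-empty window. -/
def zeroFin {n : ℕ} (h : 0 < n) : Fin n := ⟨0, h⟩

open scoped Classical in
/-- **The root label** `(univ, ∅, 0)` (needs a non-empty window; at an empty window the program is irrelevant, any label will do). [folklore] -/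
noncomputable def rootLab (m : ℕ) (h : 0 < wn m) : FLab m :=
  ⟨(univ, ∅, fun _ => zeroFin h), by simpa [zeroFin] using admB_root m⟩

/-- The symmetrised adjacency wire between two window vertices. [folklore] -/
def adjWire (u v : WV m) : Wire m := Sum.inr (.adjW u v)

/-- The signature wire `j` of a window vertex (entries towards the ordered part; window positions read the constant `false`). [folklore] -/
def sigW (u : WV m) (j : Fin (m + m)) : Wire m := sigWire (windowSet m) (Sum.inr Gt.ff) u.1 j

/-- The inputs of the root refinement: everything is a member, adjacency, the signature order and kernel. [folklore] -/
def rootIn (m : ℕ) : RIIn m where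
  mem _ := Sum.inr .tt
  adj := adjWire
  lt0 u v := Sum.inr (.sig (.less u v))
  eq0 u v := Sum.inr (.sig (.eqall u v))

end WCanon

end Summit.PneNP.PneNP.Theorems
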